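import Literature.MathematicalPhysics.QuantumFieldTheory.Balaban1983to89.B9Thm312WholeLeafRelHZM
import Literature.MathematicalPhysics.QuantumFieldTheory.Balaban1983to89.B9Thm312WholeLeafBlocksRegular
import Literature.MathematicalPhysics.QuantumFieldTheory.Balaban1983to89.B9Thm312WholeSeriesRegular
import Literature.MathematicalPhysics.QuantumFieldTheory.Balaban1983to89.B9Thm312WholeLeafCompletePairMBZ
import Literature.MathematicalPhysics.QuantumFieldTheory.Balaban1983to89.B9StateAprioriL1

/-!
# `Balaban1983to89.B9Thm312WholeLeafCompletePairMBZSL` — the LOCATED-S1 TWIN of `B9Thm312WholeLeafCompletePairMBZS` (dag-n06-l g27, p709529): [B9] Theorem 3.12 (p. 423)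
# AS THE WHOLE PRINTED LEAF `B9.Thm312Printed`, PAIR-M FACE, WITH THE PERTURBATION
# STEPS OVER A REGULAR STATE (LOCATED-U8′'s cure, row 20): `thm312Printed_completePairMBZ` with EVERY raw-state step hypothesis (`Step … 1∕2`, `LeftStep`, `StepDirB`)
# replaced by state-level objects — `StepS` on two state classes 𝔖₂ (dimension 2) ∕ 𝔖₁ (dimension 1), the one-step left-form members OUT OF them, the producers
# G₀ ∕ G₀Q\* ∕ G₀∇\*_U ∕ G₀∇\*_{U,μ} INTO them, their sup readings and ℓ¹-domination — from which the members of G AND G₁ follow by the first resolvent form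

T. Bałaban, *Propagators for lattice gauge theories in a background field*, Commun. Math. Phys. **99** (1985) 389–434 [`Balaban1985BackgroundPropagators`,
"B9"]; [4] = T. Bałaban, *Propagators and renormalization transformations for lattice gauge theories. II*, Commun. Math. Phys. **96** (1984) 223–250
[`Balaban1984PropagatorsII`].  statement-level skeleton of published theorems with citation tags; proofs where landed; nothing here is a claim about the
Yang–Mills mass gap.  Sequel of `B9Thm312WholeLeafCompletePairMBZ` (g12), `B9Thm312WholeLeafRelHZM`, `B9Thm312WholeBlocksRegular`, `B9Thm312WholeMembersRegular`,
`B9Thm312WholeSeriesRegular` (g27).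

THE PRINT.  p. 422–423: the series (3.130)∕(3.138) converge «in all norms appearing on the left-hand sides of (3.42)–(3.47)»; derivatives in Δ′_π + Δ⁽²⁾_π «have to be
applied either to the operator on the right, or on the left».  Print's induction state is REGULAR: every T = Δ′_π (+ Δ⁽²⁾_π) acts on a G₀-output carrying its Hölder sizes.

THE POINT (dag-n06-l LOCATED-U8 ∕ U8′, HOME `U8S-PROGRAMME-MEMO.md`).  The row-20 leaf of record derived the members of G₁, H₁ from one-step objects on the RAW class 𝔠⁽ᵖ⁾
(`Step.step1`, `LeftStep.stepD1`, `StepDirB.pY1 pX1 sDd1 pXd1 tDd1`), inhabited at the pins only through the four displayed Δ⁽²⁾ sup letters — beyond print at Δ⁽²⁾ ≠ 0.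
THIS LEAF takes, per member and configuration in the regime, two FREE state classes 𝔖₂ i U (length-dimension 2: the class the entries G₀, G₀Q\* live in) and 𝔖₁ i U
(dimension 1: G₀∇\*_U, G₀∇\*_{U,μ}) with: the steps `StepS` on both (θ_S·Mα₀, BOTH perturbations — g26 `stepS_of_lettersS`), the left-form one-step members out of them
(`hSD` ∇_UG₀T : 𝔖₂ → 𝔠_Y⁽¹⁾, `hPY` Φ^Y_β∇_UG₀T : 𝔖₂ → 𝔠_{PY}^{(β−1)}, `hSDd` ∇_{U,ν}G₀T : 𝔖₁ → 𝔠^{(0)}, `hPX` Φ^X_βG₀T : 𝔖₁ → 𝔠_{PX}^{(β−1)}, `hPXd` Φ^X_β∇_νG₀T : 𝔖₁ → 𝔠_{PX}^{(β)}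
— g27 `B9Thm312WholeStepDirRegular`, both perturbations), the producers (`hPG0 hPQs` INTO 𝔖₂, `hPDs hPDds` INTO 𝔖₁), the sup readings (`hRd2 hRd1`), the cutting-cost bound
`κ_S` and the ℓ¹-dominations (`hdom2 hdom1`, a-priori majorants) — and PROVES INSIDE, for A ∈ {G, G₁} alike: the right entries A, A∇\*, A∇\*_μ, H = A∘(Q\*C) IN the state
(g26 `hasMaj_right_of_stepS`), the six sup members and the (3.43)–(3.45) families (`B9Thm312WholeMembersRegular`), the L² block (`l2Block_of_members_pairM`), the Hölder block
(`ineq343_345_of_majorants_pairM`), the H-words and the Hölder member of (3.133) (`B9Thm312WholeBlocksRegular` §2), the convergence pins (`B9Thm312WholeSeriesRegular`), and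
closes by `thm312Printed_of_membersRelHZ`.  Conclusion `B9.Thm312Printed …` IDENTICAL to the leaf of record; NO raw-state step anywhere.
* ★★★ `thm312Printed_completePairMBZSL`.
LOCATED-S1 (dag-n06-d g18; director-ym №285): the as-landed leaf displays `hdomX` with the conjunct `(bHX i ε).IsLoc y μ → (ofBlocks … (𝔬 i).blk).IsLoc y μ` — the
`Letters313IMB.locX` shape, refuted at the N06 certificate's pins (`B9Letters313IMBLocObstruction.not_isLoc_bHK_imp_ofBlocks`: the input norm `bHK` is CLASS-localised,
the sharp sup class FIBRE-localised).  The leaf uses `hdomX` ONLY for the bootstrap's a-priori constant majorant; THIS TWIN is the landed text VERBATIM (dag-n06-l's pen) with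
`hdomX` re-typed as the ℓ¹ control `∀ i ε, 0 < ε → ∃ ΛX ≥ 0, ∀ y μ, (bHX i ε).IsLoc y μ → Σ_q |μ q| ≤ ΛX·(bHX i ε).loc y μ` (TRUE at the pins:
`B9StateAprioriL1.exists_l1_control_bHK`) and the one `obtain` reading it through `B9StateAprioriL1.exists_hasMaj_const_of_l1_src`; nothing else changes.
HONEST SCOPE.  Kernel-checked bookkeeping over hypothesis schemas of printed type (the state-level objects are inhabited at the pins from displayed∕derived members:
`e0 e1 e2 e1d e2d h43L h43R h43d h44m h45m hZ8 hpXDv gQs2 hpXQs h44G h43Gp hD2sup` + the Δ′_π letters); NOT a node discharge; COUNT-NEUTRAL; one finite lattice at a time —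
nothing continuum ∕ ℝ⁴ ∕ OS ∕ mass gap.  Cell `pub-ymgap` (HUMAN RULING D-0062), Track A node N06 [B9], bundle F7 row 20, seat `pub-ymgap-dag-n06-l` (g27) — twin filed by `pub-ymgap-dag-n06-d` (g18), 2026-08-29.
-/

namespace Literature.MathematicalPhysics.QuantumFieldTheory.Balaban1983to89.B9Thm312WholeLeafCompletePairMBZSL

open Literature.MathematicalPhysics.QuantumFieldTheory.Balaban1983to89
open Finset B6RandomWalk B6RandomWalkHom B9Thm34Ext B9Thm37Glue B9Thm37GlueCor36 B11SectG B9SectDSup B9SectDL2Decay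
open B9Thm37AllNorms B9Thm37AllNormsInstances B9FromB6 B9FromB6ModelSignsOn B9SectBStepWhole B9Thm312Whole B9Thm312WholeLeaf
open B9Thm312WholeLeft B9Thm312WholeH B9Thm312WholeLeafLeftGlob B9Ineq347CoReading B9SectCDiffDict B9CoRealizesRel B9CoRealizesHRel
open B9RWSums343Holder B9RWSumsReadsRel B9RWSumsReadsNbr B9Ineq347 B9Thm312WholeClasses B9Thm312WholeHolder B9Thm312WholeL2
open B9Thm312WholeBlocksRel B9Thm312WholeBlocksNbr B9Thm312WholeLeafAll B9Thm312WholeHHolder B9Thm312WholeHHolderNbr B9Thm312WholeLeafRelH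
open B9RWSums346SecondDiff B9Thm312WholeLeafCompleteNbr B9Thm312WholeBlocksNbrRec B9RWSums344InputFam B9Thm312WholeDir
open B9Thm312WholeBlocksPairM B9Thm312WholeLeafCompletePairM B9Thm312WholeDirB B9Thm312WholeBlocksPairMB B9Thm312WholeHZ B9Thm312WholeLeafRelHZ
open B9Thm312WholeStepRegular B9Thm312WholeStepDirRegular B9Thm312WholeMembersRegular B9Thm312WholeBlocksRegular B9Thm312WholeSeriesRegular
open B9Thm312WholeLeafRelHZM B9Thm312WholeLeafBlocksRegular B9Thm313WholeHolder

noncomputable section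

section Family

variable {I : Type} {d : ℕ} {c35 : ℝ} {geo : I → B9.Geometry} {bg : I → B9.Backgrounds}
variable [∀ i, Fintype (geo i).Site] [∀ i, DecidableEq (geo i).Site]
variable {X Y Z W PX PY : I → Type} {P : Type} [∀ i, Fintype (X i)] [∀ i, DecidableEq (X i)] [∀ i, Fintype (Y i)]
  [∀ i, Fintype (Z i)] [∀ i, Fintype (W i)] [∀ i, Fintype (PX i)] [∀ i, Fintype (PY i)] [Fintype P]

omit [∀ i, Fintype (X i)] [∀ i, DecidableEq (X i)] [∀ i, Fintype (Y i)] [∀ i, Fintype (Z i)] [∀ i, Fintype (W i)]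
  [∀ i, Fintype (geo i).Site] [∀ i, DecidableEq (geo i).Site] [∀ i, Fintype (PX i)] [∀ i, Fintype (PY i)] [Fintype P] in
/-- Arithmetic of *"for α₀ sufficiently small"*: t ≧ 0 and m ≦ (2(t + 1))⁻¹ give tm ≦ ½. [folklore] -/
private theorem small_auxS {t m : ℝ} (ht : 0 ≤ t) (hm : m ≤ (2 * (t + 1))⁻¹) : t * m ≤ 1 / 2 := by
  have hpos : 0 < 2 * (t + 1) := by linarith
  have h1 : t * m ≤ t * (2 * (t + 1))⁻¹ := mul_le_mul_of_nonneg_left hm ht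
  have h2 : t * (2 * (t + 1))⁻¹ ≤ 1 / 2 := by
    rw [← div_eq_mul_inv, div_le_iff₀ hpos]
    linarith
  linarith

set_option maxHeartbeats 400000 in
/-- ★★★ **THEOREM 3.12 AS THE WHOLE PRINTED LEAF `B9.Thm312Printed`, PAIR-M FACE, STEPS OVER A REGULAR STATE** (p. 423; the cure of LOCATED-U8′).  Inputs: those of
`thm312Printed_completePairMBZ` except that `hmodel` keeps only `FormSmall ∧ Identities`, `hleft` keeps only Theorem 3.3's (3.42)₂ `he1`, `hstepC` keeps only the block-L² step
`StepL2`, and the raw-state steps are REPLACED by the state-level families `hstate2` (on 𝔖₂: `StepS`, ∇_UG₀T, Φ^Y_β∇_UG₀T out of 𝔖₂; G₀, G₀Q\* INTO 𝔖₂; the sup reading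
`id : 𝔖₂ → 𝔠^{(−2)}`; κ ≦ κ_S; ℓ¹-domination) and `hstate1` (on 𝔖₁: `StepS`, ∇_{U,ν}G₀T, Φ^X_βG₀T, Φ^X_β∇_νG₀T out of 𝔖₁; G₀∇\*_U, G₀∇\*_{U,μ} (out of `bHX ε`, constant A_I(ε)) INTO
𝔖₁; `id : 𝔖₁ → 𝔠^{(−1)}`; κ ≦ κ_S; ℓ¹-domination) plus the ℓ¹ control of `bHX ε`-localised inputs (`hdomX`: `IsLoc y μ → Σ_q |μ q| ≤ Λ_X·loc y μ`, the LOCATED-S1 binder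
(R-b) — see the module docstring; NO domination of the sharp sup class is displayed).  PROVED INSIDE: everything (see the module docstring).  Output families: B(β) = max(m·CL·e^{rρ_f}(B_h β + κ_Sθ_H β·a₁·2A₀·c), C_H3·(B_qB₃c + κ_Sθ_H β·a₁·2B₃²c·c)·Lc², 0), B′(ε) = max(e^{rρ_f}(B_i ε + κ_Sθ_D·a₁·2A_I ε·c), 0),
B′(ε,β) = max(CL·e^{rρ_f}(B_i2 ε β + κ_Sθ_H β·a₁·2A_I(β+ε)·c), 0).
[cite: Balaban1985BackgroundPropagators, Thm 3.12 pp.421–423 + (3.39)–(3.47) pp.397–398 + (3.126) p.420 + (3.129) p.421 + (3.132)–(3.133) p.422; Balaban1984PropagatorsII, (2.51)–(2.52) p.232 + Lemma 2.1 (2.60)–(2.61) p.234 + (2.66) p.234] -/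
theorem thm312Printed_completePairMBZSL (𝔬 : ∀ i, Ops (geo i) (bg i) (X i) (Y i) (Z i) (W i)) (R₀ : I → ℝ) (H₀ : I → Prop)
    (𝔭 : ∀ i, HolderProbes (geo i) (bg i) (X i) (Y i) (PX i) (PY i))
    (bHX : ∀ i, ℝ → BlockNorm (toB6 (geo i) (R₀ i) (H₀ i)) (X i → ℝ))
    (Dd Dds : ∀ i, (bg i).Cfg → P → Module.End ℝ (X i → ℝ))
    (GD G₁ : ∀ i, B9.KernelFamily (geo i) (bg i)) (Hk H₁k : ∀ i, B9.HKernel (geo i) (bg i))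
    (ev : ∀ i, (geo i).Loc → X i → ℝ) (evY : ∀ i, (geo i).Loc → Y i → ℝ) {PL : ∀ i, (geo i).Loc → Prop}
    (Rel : ∀ i, (geo i).Site → (geo i).Site → Prop) [∀ i, DecidableRel (Rel i)] (m mN : ℕ)
    (𝔖₂ 𝔖₁ : ∀ i, (bg i).Cfg → BlockNorm (toB6 (geo i) (R₀ i) (H₀ i)) (X i → ℝ))
    (r Cev CL θS θD θ₂ r₁ B₀ B₂ δ₀ δK σ c ρ ρf a₁ M₁ ML B₃ δ₃ α Lc κS A₀ CR : ℝ) (Bh Bi Bq θH AI : ℝ → ℝ) (Bi2 : ℝ → ℝ → ℝ)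
    (hθS : 0 ≤ θS) (hθD : 0 ≤ θD) (hθH : ∀ β, 0 ≤ β → β < 1 → 0 ≤ θH β) (hθ₂ : 0 ≤ θ₂) (hr₁ : 0 ≤ r₁) (hB₀ : 0 ≤ B₀) (hB₂ : 0 ≤ B₂) (hB₃ : 0 ≤ B₃)
    (hκS : 1 ≤ κS) (hA₀ : 0 ≤ A₀) (hCR : 0 ≤ CR) (hAI : ∀ ε, 0 < ε → 0 ≤ AI ε)
    (hσ : 0 ≤ σ) (hρ : 0 < ρ) (hρS : ρ + 2 * σ ≤ δ₀) (hρδ : ρ + 2 * σ ≤ δK) (hρ₃ : ρ + 2 * σ ≤ δ₃) (hc : 0 ≤ c) (ha₁ : 0 < a₁) (hM₁ : 0 < M₁)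
    (hα : α ≤ 1 / 2) (hα0 : 0 ≤ α) (hρf : 0 < ρf) (hρf1 : ρf + σ ≤ (1 - α) * ρ) (hρf2 : ρf + 2 * σ + α * ρ ≤ ρ)
    (hBh : ∀ β, 0 ≤ β → β < 1 → 0 ≤ Bh β) (hBi : ∀ ε, 0 < ε → ε ≤ 1 → 0 ≤ Bi ε)
    (hBi2 : ∀ ε β, 0 < ε → ε ≤ 1 → 0 ≤ β → β < 1 → 0 ≤ Bi2 ε β) (hBq : ∀ β, 0 ≤ Bq β)
    (hCev : 0 ≤ Cev) (hCL1 : 1 ≤ CL)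
    (hgeo : ∀ i, GeoOK (geo i)) (S : ∀ i, ModelSignsOn (geo i) (PL i))
    (hL1 : ∀ i, 1 ≤ (geo i).L) (hLle : ∀ i, (geo i).L ≤ Lc) (hLc : 1 ≤ Lc) (hη : ∀ i, 0 < (geo i).eta)
    (hrow : ∀ i, ML ≤ (geo i).M → RowSum (toB6 (geo i) (R₀ i) (H₀ i)) σ c)
    (hL21 : ∀ δ : ℝ, 0 < δ → ∃ ML' c' : ℝ, Lemma21AboveG geo R₀ H₀ δ α ML' c')
    (hnbr : ∀ (i : I) (y : (geo i).Site), (nbr (geo i) r y).card ≤ mN)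
    (hCL : ∀ (i : I) (a a' : (geo i).Site), (geo i).dist a a' ≤ r → (geo i).len a ≤ CL * (geo i).len a')
    (hsat : ∀ (i : I) (n : Fin 4) (B' δ' : ℝ),
      (∀ a a' b, Rel i a a' → maj342 (geo i) n B' δ' a b = maj342 (geo i) n B' δ' a' b) ∧
      (∀ a b b', Rel i b b' → maj342 (geo i) n B' δ' a b = maj342 (geo i) n B' δ' a b'))
    (hmult : ∀ (i : I) (y' : (geo i).Site), (Finset.univ.filter (fun y'' => Rel i y'' y')).card ≤ m)
    (hRdist : ∀ (i : I) (a a' b : (geo i).Site), Rel i a a' → (geo i).dist a b = (geo i).dist a' b)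
    (hRlen : ∀ (i : I) (a a' : (geo i).Site), Rel i a a' → (geo i).len a = (geo i).len a')
    (hcoR : ∀ (i : I) (U : (bg i).Cfg),
      CoRealizesRel (GD i) 0 U (Rel i) (𝔬 i).blk (𝔬 i).blk (ev i) ((𝔬 i).G U) ∧
      CoRealizesRel (GD i) 2 U (Rel i) (𝔬 i).blk (𝔬 i).blkY (evY i) ((𝔬 i).G U ∘ₗ (𝔬 i).Dstar U) ∧
      CoRealizesRel (G₁ i) 0 U (Rel i) (𝔬 i).blk (𝔬 i).blk (ev i) ((𝔬 i).G1 U) ∧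
      CoRealizesRel (G₁ i) 2 U (Rel i) (𝔬 i).blk (𝔬 i).blkY (evY i) ((𝔬 i).G1 U ∘ₗ (𝔬 i).Dstar U))
    (hco1R : ∀ (i : I) (U : (bg i).Cfg),
      CoRealizesRel (GD i) 1 U (Rel i) (𝔬 i).blkY (𝔬 i).blk (ev i) ((𝔬 i).D U ∘ₗ (𝔬 i).G U) ∧
      CoRealizesRel (G₁ i) 1 U (Rel i) (𝔬 i).blkY (𝔬 i).blk (ev i) ((𝔬 i).D U ∘ₗ (𝔬 i).G1 U))
    (hcoHR : ∀ (i : I) (U : (bg i).Cfg),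
      CoRealizesHRel (Hk i) 0 U d (Rel i) (𝔬 i).blk (𝔬 i).blkZ ((𝔬 i).Hm U) ∧
      CoRealizesHRel (Hk i) 1 U d (Rel i) (𝔬 i).blkY (𝔬 i).blkZ ((𝔬 i).D U ∘ₗ (𝔬 i).Hm U) ∧
      CoRealizesHRel (H₁k i) 0 U d (Rel i) (𝔬 i).blk (𝔬 i).blkZ ((𝔬 i).H1m U) ∧
      CoRealizesHRel (H₁k i) 1 U d (Rel i) (𝔬 i).blkY (𝔬 i).blkZ ((𝔬 i).D U ∘ₗ (𝔬 i).H1m U))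
    (hcoG : ∀ (i : I) (U : (bg i).Cfg),
      CoReadsGlob (GD i) 0 U (𝔬 i).blk (𝔬 i).blk (ev i) ((𝔬 i).G U) ∧
      CoReadsGlob (GD i) 1 U (𝔬 i).blkY (𝔬 i).blk (ev i) ((𝔬 i).D U ∘ₗ (𝔬 i).G U) ∧
      CoReadsGlob (GD i) 2 U (𝔬 i).blk (𝔬 i).blkY (evY i) ((𝔬 i).G U ∘ₗ (𝔬 i).Dstar U) ∧
      CoReadsGlob (G₁ i) 0 U (𝔬 i).blk (𝔬 i).blk (ev i) ((𝔬 i).G1 U) ∧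
      CoReadsGlob (G₁ i) 1 U (𝔬 i).blkY (𝔬 i).blk (ev i) ((𝔬 i).D U ∘ₗ (𝔬 i).G1 U) ∧
      CoReadsGlob (G₁ i) 2 U (𝔬 i).blk (𝔬 i).blkY (evY i) ((𝔬 i).G1 U ∘ₗ (𝔬 i).Dstar U))
    (hl2N : ∀ (i : I) (U : (bg i).Cfg),
      (L2ReadsNbr (R := R₀ i) (H := H₀ i) (GD i) 0 U (Rel i) r Cev (𝔬 i).blk (𝔬 i).blk (ev i) ((𝔬 i).G U) ∧
        L2ReadsNbr (R := R₀ i) (H := H₀ i) (GD i) 1 U (Rel i) r Cev (𝔬 i).blkY (𝔬 i).blk (ev i) ((𝔬 i).D U ∘ₗ (𝔬 i).G U) ∧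
        L2ReadsNbr (R := R₀ i) (H := H₀ i) (GD i) 2 U (Rel i) r Cev (𝔬 i).blk (𝔬 i).blkY (evY i) ((𝔬 i).G U ∘ₗ (𝔬 i).Dstar U) ∧
        L2ReadsNbr (R := R₀ i) (H := H₀ i) (GD i) 3 U (Rel i) r Cev ((𝔬 i).blk ∘ Prod.fst) (𝔬 i).blk (ev i)
          (familyOp (fun q : P × P => Dd i U q.1 ∘ₗ ((𝔬 i).G U ∘ₗ Dds i U q.2))) ∧
        L2ReadsNbr (R := R₀ i) (H := H₀ i) (GD i) 4 U (Rel i) r Cev ((𝔬 i).blk ∘ Prod.fst) (𝔬 i).blk (ev i)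
          (familyOp (fun q : P × P => (Dd i U q.1 ∘ₗ Dd i U q.2) ∘ₗ (𝔬 i).G U)) ∧
        L2ReadsNbr (R := R₀ i) (H := H₀ i) (GD i) 5 U (Rel i) r Cev ((𝔬 i).blk ∘ Prod.fst) (𝔬 i).blk (ev i)
          (familyOp (fun q : P × P => (𝔬 i).G U ∘ₗ (Dds i U q.1 ∘ₗ Dds i U q.2)))) ∧
      (L2ReadsNbr (R := R₀ i) (H := H₀ i) (G₁ i) 0 U (Rel i) r Cev (𝔬 i).blk (𝔬 i).blk (ev i) ((𝔬 i).G1 U) ∧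
        L2ReadsNbr (R := R₀ i) (H := H₀ i) (G₁ i) 1 U (Rel i) r Cev (𝔬 i).blkY (𝔬 i).blk (ev i) ((𝔬 i).D U ∘ₗ (𝔬 i).G1 U) ∧
        L2ReadsNbr (R := R₀ i) (H := H₀ i) (G₁ i) 2 U (Rel i) r Cev (𝔬 i).blk (𝔬 i).blkY (evY i) ((𝔬 i).G1 U ∘ₗ (𝔬 i).Dstar U) ∧
        L2ReadsNbr (R := R₀ i) (H := H₀ i) (G₁ i) 3 U (Rel i) r Cev ((𝔬 i).blk ∘ Prod.fst) (𝔬 i).blk (ev i)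
          (familyOp (fun q : P × P => Dd i U q.1 ∘ₗ ((𝔬 i).G1 U ∘ₗ Dds i U q.2))) ∧
        L2ReadsNbr (R := R₀ i) (H := H₀ i) (G₁ i) 4 U (Rel i) r Cev ((𝔬 i).blk ∘ Prod.fst) (𝔬 i).blk (ev i)
          (familyOp (fun q : P × P => (Dd i U q.1 ∘ₗ Dd i U q.2) ∘ₗ (𝔬 i).G1 U)) ∧
        L2ReadsNbr (R := R₀ i) (H := H₀ i) (G₁ i) 5 U (Rel i) r Cev ((𝔬 i).blk ∘ Prod.fst) (𝔬 i).blk (ev i)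
          (familyOp (fun q : P × P => (𝔬 i).G1 U ∘ₗ (Dds i U q.1 ∘ₗ Dds i U q.2)))))
    (hH1N : ∀ (i : I) (U : (bg i).Cfg),
      H1ReadsNbr (GD i) U (𝔭 i) (Rel i) r (𝔬 i).blk (𝔬 i).blkY (ev i) (evY i) ((𝔬 i).D U ∘ₗ (𝔬 i).G U)
        ((𝔬 i).G U ∘ₗ (𝔬 i).Dstar U) ∧
      H1ReadsNbr (G₁ i) U (𝔭 i) (Rel i) r (𝔬 i).blk (𝔬 i).blkY (ev i) (evY i) ((𝔬 i).D U ∘ₗ (𝔬 i).G1 U)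
        ((𝔬 i).G1 U ∘ₗ (𝔬 i).Dstar U))
    (hIF : ∀ (i : I) (U : (bg i).Cfg),
      InputReadsFam (GD i) U (bHX i) r ((𝔬 i).blk ∘ Prod.fst) ((𝔭 i).blkPX ∘ Prod.fst) (fun β => sliceProbe ((𝔭 i).ΦX U β)) (ev i)
        (familyOp (fun q : P × P => Dd i U q.1 ∘ₗ ((𝔬 i).G U ∘ₗ Dds i U q.2))) ∧
      InputReadsFam (G₁ i) U (bHX i) r ((𝔬 i).blk ∘ Prod.fst) ((𝔭 i).blkPX ∘ Prod.fst) (fun β => sliceProbe ((𝔭 i).ΦX U β)) (ev i)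
        (familyOp (fun q : P × P => Dd i U q.1 ∘ₗ ((𝔬 i).G1 U ∘ₗ Dds i U q.2))))
    (hHCN : ∀ (i : I) (U : (bg i).Cfg),
      CoReadsHHolderNbr (Hk i) U d (𝔭 i) r (𝔬 i).blkZ ((𝔬 i).D U ∘ₗ (𝔬 i).Hm U) ∧
      CoReadsHHolderNbr (H₁k i) U d (𝔭 i) r (𝔬 i).blkZ ((𝔬 i).D U ∘ₗ (𝔬 i).H1m U))
    (hsym : ∀ i, M₁ ≤ (geo i).M → ∀ α₀ : ℝ, 0 < α₀ → (geo i).M * α₀ ≤ a₁ →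
      ∀ U : (bg i).Cfg, (bg i).Reg335 c35 α₀ U → (bg i).Reg336 c35 α₀ U →
        (IsTransposePair ((𝔬 i).G U) ((𝔬 i).G U) ∧ IsTransposePair ((𝔬 i).G1 U) ((𝔬 i).G1 U)) ∧
        (IsTransposePair ((𝔬 i).D U ∘ₗ (𝔬 i).G U) ((𝔬 i).G U ∘ₗ (𝔬 i).Dstar U) ∧
          IsTransposePair ((𝔬 i).D U ∘ₗ (𝔬 i).G1 U) ((𝔬 i).G1 U ∘ₗ (𝔬 i).Dstar U)))
    (hmodel : ∀ i, M₁ ≤ (geo i).M → ∀ α₀ : ℝ, 0 < α₀ → (geo i).M * α₀ ≤ a₁ →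
      ∀ U : (bg i).Cfg, (bg i).Reg335 c35 α₀ U → (bg i).Reg336 c35 α₀ U →
        FormSmall (𝔬 i) (r₁ * ((geo i).M * α₀)) U ∧ Identities (𝔬 i) U)
    (he1 : ∀ i, M₁ ≤ (geo i).M → ∀ α₀ : ℝ, 0 < α₀ → (geo i).M * α₀ ≤ a₁ →
      ∀ U : (bg i).Cfg, (bg i).Reg335 c35 α₀ U → (bg i).Reg336 c35 α₀ U →
        HasMajorantHom (g := toB6 (geo i) (R₀ i) (H₀ i)) (𝔬 i).blk (𝔬 i).blkY ((𝔬 i).D U ∘ₗ (𝔬 i).G0 U)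
          (fun (a b : (geo i).Site) => B₀ * (geo i).len a * Real.exp (-(δ₀ * (geo i).dist a b))))
    (bZ : ∀ i, BlockNorm (toB6 (geo i) (R₀ i) (H₀ i)) (Z i → ℝ)) (hκZ : ∀ i, (bZ i).κ = 1)
    (hlettersH : ∀ i, M₁ ≤ (geo i).M → ∀ α₀ : ℝ, 0 < α₀ → (geo i).M * α₀ ≤ a₁ →
      ∀ U : (bg i).Cfg, (bg i).Reg335 c35 α₀ U → (bg i).Reg336 c35 α₀ U →
        LettersHZ (𝔬 i) (R₀ i) (H₀ i) (hgeo i) (bZ i) B₃ δ₃ U)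
    (hG0C : ∀ i, M₁ ≤ (geo i).M → ∀ α₀ : ℝ, 0 < α₀ → (geo i).M * α₀ ≤ a₁ →
      ∀ U : (bg i).Cfg, (bg i).Reg335 c35 α₀ U → (bg i).Reg336 c35 α₀ U →
        Thm33G0Dir (𝔬 i) (𝔭 i) (Dd i) (Dds i) (R₀ i) (H₀ i) (bHX i) B₀ Bh Bi Bi2 δ₀ U ∧
          Thm33G0L2M (𝔬 i) (Dd i) (Dds i) (R₀ i) (H₀ i) B₂ δ₀ U)
    (hStL : ∀ i, M₁ ≤ (geo i).M → ∀ α₀ : ℝ, 0 < α₀ → (geo i).M * α₀ ≤ a₁ →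
      ∀ U : (bg i).Cfg, (bg i).Reg335 c35 α₀ U → (bg i).Reg336 c35 α₀ U →
        StepL2 (𝔬 i) (R₀ i) (H₀ i) (θ₂ * ((geo i).M * α₀)) δK U)
    (hLHH : ∀ i, M₁ ≤ (geo i).M → ∀ α₀ : ℝ, 0 < α₀ → (geo i).M * α₀ ≤ a₁ →
      ∀ U : (bg i).Cfg, (bg i).Reg335 c35 α₀ U → (bg i).Reg336 c35 α₀ U →
        LettersHHZ (𝔬 i) (𝔭 i) (R₀ i) (H₀ i) (hgeo i).lenle (bZ i) Bq δ₃ U)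
    (hdomX : ∀ (i : I) (ε : ℝ), 0 < ε → ∃ ΛX : ℝ, 0 ≤ ΛX ∧
      ∀ (y : (geo i).Site) (μ : X i → ℝ), (bHX i ε).IsLoc y μ → ∑ q : X i, |μ q| ≤ ΛX * (bHX i ε).loc y μ)
    (hstate2 : ∀ i, M₁ ≤ (geo i).M → ∀ α₀ : ℝ, 0 < α₀ → (geo i).M * α₀ ≤ a₁ →
      ∀ U : (bg i).Cfg, (bg i).Reg335 c35 α₀ U → (bg i).Reg336 c35 α₀ U →
        StepS (𝔬 i) (𝔖₂ i U) (θS * ((geo i).M * α₀)) δK U ∧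
        (HasMaj (𝔖₂ i U) (cNorm (R₀ i) (H₀ i) (𝔬 i).blkY (hgeo i).lenle 1) ((𝔬 i).D U ∘ₗ (𝔬 i).G0 U ∘ₗ (𝔬 i).Tpi U)
            (fun a b => θD * ((geo i).M * α₀) * Real.exp (-(δK * (geo i).dist a b))) ∧
          HasMaj (𝔖₂ i U) (cNorm (R₀ i) (H₀ i) (𝔬 i).blkY (hgeo i).lenle 1) ((𝔬 i).D U ∘ₗ (𝔬 i).G0 U ∘ₗ ((𝔬 i).Tpi U + (𝔬 i).T2 U))
            (fun a b => θD * ((geo i).M * α₀) * Real.exp (-(δK * (geo i).dist a b)))) ∧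
        (∀ β : ℝ, 0 ≤ β → β < 1 →
          HasMaj (𝔖₂ i U) (cNormR (R₀ i) (H₀ i) (𝔭 i).blkPY (hgeo i).lenle (β - 1)) (((𝔭 i).ΦY U β ∘ₗ (𝔬 i).D U ∘ₗ (𝔬 i).G0 U) ∘ₗ (𝔬 i).Tpi U)
              (fun a b => θH β * ((geo i).M * α₀) * Real.exp (-(δK * (geo i).dist a b))) ∧
            HasMaj (𝔖₂ i U) (cNormR (R₀ i) (H₀ i) (𝔭 i).blkPY (hgeo i).lenle (β - 1))
              (((𝔭 i).ΦY U β ∘ₗ (𝔬 i).D U ∘ₗ (𝔬 i).G0 U) ∘ₗ ((𝔬 i).Tpi U + (𝔬 i).T2 U))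
              (fun a b => θH β * ((geo i).M * α₀) * Real.exp (-(δK * (geo i).dist a b)))) ∧
        HasMaj (cNorm (R₀ i) (H₀ i) (𝔬 i).blk (hgeo i).lenle 0) (𝔖₂ i U) ((𝔬 i).G0 U)
          (fun a b => A₀ * Real.exp (-(δ₀ * (geo i).dist a b))) ∧
        HasMaj (bZ i) (𝔖₂ i U) ((𝔬 i).G0 U ∘ₗ (𝔬 i).Qstar U) (fun a b => B₃ * Real.exp (-(δ₃ * (geo i).dist a b))) ∧
        HasMaj (𝔖₂ i U) (cNormR (R₀ i) (H₀ i) (𝔬 i).blk (hgeo i).lenle (-2)) LinearMap.id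
          (fun a b => CR * Real.exp (-(δ₀ * (geo i).dist a b))) ∧
        (𝔖₂ i U).κ ≤ κS ∧
        (∃ Λ : ℝ, 0 ≤ Λ ∧ ∀ (y : (geo i).Site) (F : X i → ℝ), (𝔖₂ i U).loc y F ≤ Λ * ∑ x : X i, |F x|))
    (hstate1 : ∀ i, M₁ ≤ (geo i).M → ∀ α₀ : ℝ, 0 < α₀ → (geo i).M * α₀ ≤ a₁ →
      ∀ U : (bg i).Cfg, (bg i).Reg335 c35 α₀ U → (bg i).Reg336 c35 α₀ U →
        StepS (𝔬 i) (𝔖₁ i U) (θS * ((geo i).M * α₀)) δK U ∧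
        (∀ ν : P,
          HasMaj (𝔖₁ i U) (cNormR (R₀ i) (H₀ i) (𝔬 i).blk (hgeo i).lenle 0) (Dd i U ν ∘ₗ (𝔬 i).G0 U ∘ₗ (𝔬 i).Tpi U)
              (fun a b => θD * ((geo i).M * α₀) * Real.exp (-(δK * (geo i).dist a b))) ∧
            HasMaj (𝔖₁ i U) (cNormR (R₀ i) (H₀ i) (𝔬 i).blk (hgeo i).lenle 0) (Dd i U ν ∘ₗ (𝔬 i).G0 U ∘ₗ ((𝔬 i).Tpi U + (𝔬 i).T2 U))
              (fun a b => θD * ((geo i).M * α₀) * Real.exp (-(δK * (geo i).dist a b)))) ∧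
        (∀ β : ℝ, 0 ≤ β → β < 1 →
          HasMaj (𝔖₁ i U) (cNormR (R₀ i) (H₀ i) (𝔭 i).blkPX (hgeo i).lenle (β - 1)) (((𝔭 i).ΦX U β ∘ₗ (𝔬 i).G0 U) ∘ₗ (𝔬 i).Tpi U)
              (fun a b => θH β * ((geo i).M * α₀) * Real.exp (-(δK * (geo i).dist a b))) ∧
            HasMaj (𝔖₁ i U) (cNormR (R₀ i) (H₀ i) (𝔭 i).blkPX (hgeo i).lenle (β - 1)) (((𝔭 i).ΦX U β ∘ₗ (𝔬 i).G0 U) ∘ₗ ((𝔬 i).Tpi U + (𝔬 i).T2 U))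
              (fun a b => θH β * ((geo i).M * α₀) * Real.exp (-(δK * (geo i).dist a b)))) ∧
        (∀ (ν : P) (β : ℝ), 0 ≤ β → β < 1 →
          HasMaj (𝔖₁ i U) (cNormR (R₀ i) (H₀ i) (𝔭 i).blkPX (hgeo i).lenle β) (((𝔭 i).ΦX U β ∘ₗ Dd i U ν ∘ₗ (𝔬 i).G0 U) ∘ₗ (𝔬 i).Tpi U)
              (fun a b => θH β * ((geo i).M * α₀) * Real.exp (-(δK * (geo i).dist a b))) ∧
            HasMaj (𝔖₁ i U) (cNormR (R₀ i) (H₀ i) (𝔭 i).blkPX (hgeo i).lenle β) (((𝔭 i).ΦX U β ∘ₗ Dd i U ν ∘ₗ (𝔬 i).G0 U) ∘ₗ ((𝔬 i).Tpi U + (𝔬 i).T2 U))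
              (fun a b => θH β * ((geo i).M * α₀) * Real.exp (-(δK * (geo i).dist a b)))) ∧
        HasMaj (cNormR (R₀ i) (H₀ i) (𝔬 i).blkY (hgeo i).lenle 0) (𝔖₁ i U) ((𝔬 i).G0 U ∘ₗ (𝔬 i).Dstar U)
          (fun a b => A₀ * Real.exp (-(δ₀ * (geo i).dist a b))) ∧
        (∀ (μ : P) (ε : ℝ), 0 < ε → HasMaj (bHX i ε) (𝔖₁ i U) ((𝔬 i).G0 U ∘ₗ Dds i U μ)
          (fun a b => AI ε * Real.exp (-(δ₀ * (geo i).dist a b)))) ∧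
        HasMaj (𝔖₁ i U) (cNormR (R₀ i) (H₀ i) (𝔬 i).blk (hgeo i).lenle (-1)) LinearMap.id
          (fun a b => CR * Real.exp (-(δ₀ * (geo i).dist a b))) ∧
        (𝔖₁ i U).κ ≤ κS ∧
        (∃ Λ : ℝ, 0 ≤ Λ ∧ ∀ (y : (geo i).Site) (F : X i → ℝ), (𝔖₁ i U).loc y F ≤ Λ * ∑ x : X i, |F x|)) :
    B9.Thm312Printed d c35 geo bg GD G₁ Hk H₁k (fun i => HasRWExpOfOps (𝔬 i)) (fun i => HasRWExpHOfOps (𝔬 i))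
      (fun i => PosDefKOfOps (𝔬 i)) := by
  -- thresholds and uniform constants
  obtain ⟨MLg, cg, hLg⟩ := hL21 ρ hρ
  set M₁' : ℝ := max (max M₁ ML) MLg with hM₁'
  have hM₁'pos : 0 < M₁' := lt_max_of_lt_left (lt_max_of_lt_left hM₁)
  have hle₁ : ∀ {i : I}, M₁' ≤ (geo i).M → M₁ ≤ (geo i).M := fun h => ((le_max_left _ _).trans (le_max_left _ _)).trans h
  have hleL : ∀ {i : I}, M₁' ≤ (geo i).M → ML ≤ (geo i).M := fun h => ((le_max_right _ _).trans (le_max_left _ _)).trans h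
  have hleg : ∀ {i : I}, M₁' ≤ (geo i).M → MLg ≤ (geo i).M := fun h => (le_max_right _ _).trans h
  have hκS0 : 0 ≤ κS := zero_le_one.trans hκS
  have hκθc : 0 ≤ κS * θS * c := mul_nonneg (mul_nonneg hκS0 hθS) hc
  have hB₂c : 0 ≤ B₂ * θ₂ * c * c := mul_nonneg (mul_nonneg (mul_nonneg hB₂ hθ₂) hc) hc
  set a₁' : ℝ := min a₁ (min (2 * (κS * θS * c + 1))⁻¹ (2 * (B₂ * θ₂ * c * c + 1))⁻¹) with ha₁'
  have ha₁'pos : 0 < a₁' := lt_min ha₁ (lt_min (inv_pos.mpr (by linarith)) (inv_pos.mpr (by linarith)))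
  have ha₁'le : a₁' ≤ a₁ := min_le_left _ _
  have hLc0 : 0 ≤ Lc := zero_le_one.trans hLc
  have hLc2 : 0 ≤ Lc ^ (2 : ℝ) := Real.rpow_nonneg hLc0 _
  set Λu : ℝ := Lc ^ (4 : ℝ) with hΛu
  have hΛu0 : 0 ≤ Λu := Real.rpow_nonneg hLc0 _
  have hB33 : 0 ≤ B₃ * B₃ * c := mul_nonneg (mul_nonneg hB₃ hB₃) hc
  set NP : ℝ := Real.sqrt (Fintype.card (P × P)) with hNP
  have hNP0 : 0 ≤ NP := Real.sqrt_nonneg _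
  have hm00 : (0 : ℝ) ≤ m := Nat.cast_nonneg m
  have hmN0 : (0 : ℝ) ≤ mN := Nat.cast_nonneg mN
  -- the uniform member constants: A′ = A(1 − κθc)⁻¹ ≦ 2A, θ·Mα₀ ≦ θ·a₁
  set Bm : ℝ := B₀ + κS * CR * (2 * A₀) * c + κS * (θD * a₁) * (2 * A₀) * c with hBm
  have hBm1 : 0 ≤ κS * CR * (2 * A₀) * c := mul_nonneg (mul_nonneg (mul_nonneg hκS0 hCR) (by linarith)) hc
  have hBm2 : 0 ≤ κS * (θD * a₁) * (2 * A₀) * c := mul_nonneg (mul_nonneg (mul_nonneg hκS0 (mul_nonneg hθD ha₁.le)) (by linarith)) hc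
  have hBm0 : 0 ≤ Bm := add_nonneg (add_nonneg hB₀ hBm1) hBm2
  set K₄u : ℝ := B₂ + B₂ * (θ₂ * a₁ * (2 * B₂) * c) * c with hK₄u
  have hK₄u0 : 0 ≤ K₄u := add_nonneg hB₂ (mul_nonneg (mul_nonneg hB₂ (mul_nonneg (mul_nonneg (mul_nonneg hθ₂ ha₁.le) (by linarith)) hc)) hc)
  set KLu : ℝ := Bm * Λu + Bm * Λu + (NP * K₄u + NP * K₄u * Λu + NP * K₄u * Λu) with hKLu
  have hKLu0 : 0 ≤ KLu := add_nonneg (add_nonneg (mul_nonneg hBm0 hΛu0) (mul_nonneg hBm0 hΛu0))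
    (add_nonneg (add_nonneg (mul_nonneg hNP0 hK₄u0) (mul_nonneg (mul_nonneg hNP0 hK₄u0) hΛu0)) (mul_nonneg (mul_nonneg hNP0 hK₄u0) hΛu0))
  set Fr : ℝ := (mN : ℝ) * m * Cev * CL ^ 2 * Real.exp (r * ρf) with hFr
  have hFr0 : 0 ≤ Fr := mul_nonneg (mul_nonneg (mul_nonneg (mul_nonneg hmN0 hm00) hCev) (sq_nonneg _)) (Real.exp_nonneg _)
  set BL2 : ℝ := max (Fr * KLu) 0 with hBL2
  have hBL20 : 0 ≤ BL2 := le_max_right _ _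
  set KHu : ℝ := 2 * (B₃ * B₃ * c) with hKHu
  have hKHu0 : 0 ≤ KHu := by positivity
  set BHm : ℝ := B₃ * B₃ * c + κS * CR * KHu * c + κS * (θD * a₁) * KHu * c with hBHm
  have hBHm1 : 0 ≤ κS * CR * KHu * c := mul_nonneg (mul_nonneg (mul_nonneg hκS0 hCR) hKHu0) hc
  have hBHm2 : 0 ≤ κS * (θD * a₁) * KHu * c := mul_nonneg (mul_nonneg (mul_nonneg hκS0 (mul_nonneg hθD ha₁.le)) hKHu0) hc
  have hBHm0 : 0 ≤ BHm := add_nonneg (add_nonneg hB33 hBHm1) hBHm2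
  set CH3 : ℝ := CL ^ 2 * Real.exp (r * ((1 - α) * ρ)) with hCH3
  have hCH30 : 0 ≤ CH3 := mul_nonneg (sq_nonneg _) (Real.exp_nonneg _)
  set tH : ℝ → ℝ := fun β => θH β * a₁ with htH
  have htH0 : ∀ β, 0 ≤ β → β < 1 → 0 ≤ tH β := fun β h0 h1 => mul_nonneg (hθH β h0 h1) ha₁.le
  set Bhu : ℝ → ℝ := fun β => Bh β + κS * tH β * (2 * A₀) * c with hBhu
  have hBhu0 : ∀ β, 0 ≤ β → β < 1 → 0 ≤ Bhu β := fun β h0 h1 =>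
    add_nonneg (hBh β h0 h1) (mul_nonneg (mul_nonneg (mul_nonneg hκS0 (htH0 β h0 h1)) (by linarith)) hc)
  set BβH : ℝ → ℝ := fun β => CH3 * ((Bq β * B₃ * c + κS * tH β * KHu * c) * Lc ^ (2 : ℝ)) with hBβH
  have hBβH0 : ∀ β, 0 ≤ β → β < 1 → 0 ≤ BβH β := fun β h0 h1 =>
    mul_nonneg hCH30 (mul_nonneg (add_nonneg (mul_nonneg (mul_nonneg (hBq β) hB₃) hc)
      (mul_nonneg (mul_nonneg (mul_nonneg hκS0 (htH0 β h0 h1)) hKHu0) hc)) hLc2)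
  set Bβo : ℝ → ℝ := fun β => max (max ((m : ℝ) * CL * Real.exp (r * ρf) * Bhu β) (BβH β)) 0 with hBβo
  have hBβo0 : ∀ β, 0 ≤ Bβo β := fun β => le_max_right _ _
  set Bεo : ℝ → ℝ := fun ε => max (Real.exp (r * ρf) * (Bi ε + κS * (θD * a₁) * (2 * AI ε) * c)) 0 with hBεo
  have hBεo0 : ∀ ε, 0 ≤ Bεo ε := fun ε => le_max_right _ _
  set Bεβo : ℝ → ℝ → ℝ := fun ε β => max (CL * Real.exp (r * ρf) * (Bi2 ε β + κS * tH β * (2 * AI (β + ε)) * c)) 0 with hBεβo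
  have hBεβo0 : ∀ ε β, 0 ≤ Bεβo ε β := fun ε β => le_max_right _ _
  -- the per-member assembly: members, H-words, pins and residual, all from the regular state
  have key : ∀ i, M₁' ≤ (geo i).M → ∀ α₀ : ℝ, 0 < α₀ → (geo i).M * α₀ ≤ a₁' →
      ∀ U : (bg i).Cfg, (bg i).Reg335 c35 α₀ U → (bg i).Reg336 c35 α₀ U →
        (∀ A ∈ [(𝔬 i).G U, (𝔬 i).G1 U],
          HasMajorant (g := toB6 (geo i) (R₀ i) (H₀ i)) (𝔬 i).blk A
            (fun a b => Bm * (geo i).len a ^ 2 * Real.exp (-(ρ * (geo i).dist a b))) ∧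
          HasMajorantHom (g := toB6 (geo i) (R₀ i) (H₀ i)) (𝔬 i).blk (𝔬 i).blkY ((𝔬 i).D U ∘ₗ A)
            (fun (a b : (geo i).Site) => Bm * (geo i).len a * Real.exp (-(ρ * (geo i).dist a b))) ∧
          HasMajorantHom (g := toB6 (geo i) (R₀ i) (H₀ i)) (𝔬 i).blkY (𝔬 i).blk (A ∘ₗ (𝔬 i).Dstar U)
            (fun (a b : (geo i).Site) => Bm * (geo i).len a * Real.exp (-(ρ * (geo i).dist a b)))) ∧
        (∀ Hop ∈ [(𝔬 i).Hm U, (𝔬 i).H1m U],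
          HasMaj (cNorm (R₀ i) (H₀ i) (𝔬 i).blkZ (hgeo i).lenle 2) (cNorm (R₀ i) (H₀ i) (𝔬 i).blk (hgeo i).lenle 2) Hop
            (fun a b => BHm * Real.exp (-(ρ * (geo i).dist a b))) ∧
          HasMaj (cNorm (R₀ i) (H₀ i) (𝔬 i).blkZ (hgeo i).lenle 2) (cNorm (R₀ i) (H₀ i) (𝔬 i).blkY (hgeo i).lenle 1) ((𝔬 i).D U ∘ₗ Hop)
            (fun a b => BHm * Real.exp (-(ρ * (geo i).dist a b)))) ∧
        ((∀ (K : B9.KernelFamily (geo i) (bg i)) (δ : ℝ), HasRWExpOfOps (𝔬 i) K U δ) ∧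
          (∀ (Hk' : B9.HKernel (geo i) (bg i)) (δ : ℝ), HasRWExpHOfOps (𝔬 i) Hk' U δ)) ∧
        ((∀ K ∈ [GD i, G₁ i], L2Block K BL2 ρf U ∧ B9.Ineq343_345 K Bβo Bεo Bεβo ρf U) ∧
          (∀ Hk' ∈ [Hk i, H₁k i], ∀ (β : ℝ) (ζ : (geo i).Cut) (y y' : (geo i).Site), 0 ≤ β → β < 1 → (geo i).cutInT ζ y →
            Hk'.h U β ζ y' ≤ Bβo β * (geo i).cutH β ζ * ((geo i).len y) ^ (-(1 + β)) * ((geo i).len y') ^ (-(d : ℝ)) *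
              Real.exp (-(ρf / 2 * (geo i).dist y y')))) := by
    intro i hM α₀ hα₀ hMa U hU hU'
    have hM₁i : M₁ ≤ (geo i).M := hle₁ hM
    have hMpos : 0 < (geo i).M := hM₁.trans_le hM₁i
    have hmα0 : 0 ≤ (geo i).M * α₀ := (mul_pos hMpos hα₀).le
    have hma₁ : (geo i).M * α₀ ≤ a₁ := hMa.trans ha₁'le
    have hmθ : (geo i).M * α₀ ≤ (2 * (κS * θS * c + 1))⁻¹ := hMa.trans ((min_le_right _ _).trans (min_le_left _ _))
    have hm₂ : (geo i).M * α₀ ≤ (2 * (B₂ * θ₂ * c * c + 1))⁻¹ := hMa.trans ((min_le_right _ _).trans (min_le_right _ _))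
    obtain ⟨hF, hI⟩ := hmodel i hM₁i α₀ hα₀ hma₁ U hU hU'
    have he1i := he1 i hM₁i α₀ hα₀ hma₁ U hU hU'
    have hLH := hlettersH i hM₁i α₀ hα₀ hma₁ U hU hU'
    obtain ⟨hH0, hL2s⟩ := hG0C i hM₁i α₀ hα₀ hma₁ U hU hU'
    have hStLi := hStL i hM₁i α₀ hα₀ hma₁ U hU hU'
    have hHH := hLHH i hM₁i α₀ hα₀ hma₁ U hU hU'
    obtain ⟨hS2, hSD, hPY, hPG0, hPQs, hRd2, hκ2, Λ₂, hΛ₂, hdom2⟩ := hstate2 i hM₁i α₀ hα₀ hma₁ U hU hU'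
    obtain ⟨hS1, hSDd, hPX, hPXd, hPDs, hPDds, hRd1, hκ1, Λ₁, hΛ₁, hdom1⟩ := hstate1 i hM₁i α₀ hα₀ hma₁ U hU hU'
    have hrowi := hrow i (hleL hM)
    obtain ⟨h260, -, hsize⟩ := hLg i (hleg hM)
    obtain ⟨⟨hlD0, hlD1, hlD2, hlD3, hlD4, hlD5⟩, ⟨hl10, hl11, hl12, hl13, hl14, hl15⟩⟩ := hl2N i U
    obtain ⟨hH1D, hH11⟩ := hH1N i U
    obtain ⟨hIRD, hIR1⟩ := hIF i U
    obtain ⟨hHC0, hHC1⟩ := hHCN i U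
    obtain ⟨⟨hsymG, hsymG1⟩, ⟨htrG, htrG1⟩⟩ := hsym i hM₁i α₀ hα₀ hma₁ U hU hU'
    have hlen := (hgeo i).lenle
    have hRd₂ : ∀ a b b' : (geo i).Site, Rel i b b' → (geo i).dist a b = (geo i).dist a b' := fun a b b' h => by
      rw [(hgeo i).symm a b, (hgeo i).symm a b', hRdist i b b' a h]
    -- the small factors of this member
    set θ : ℝ := θS * ((geo i).M * α₀) with hθdef
    set θ' : ℝ := θD * ((geo i).M * α₀) with hθ'def
    set θH' : ℝ → ℝ := fun β => θH β * ((geo i).M * α₀) with hθH'def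
    set θ₂' : ℝ := θ₂ * ((geo i).M * α₀) with hθ₂'def
    have hθ : 0 ≤ θ := mul_nonneg hθS hmα0
    have hθ' : 0 ≤ θ' := mul_nonneg hθD hmα0
    have hθH' : ∀ β, 0 ≤ β → β < 1 → 0 ≤ θH' β := fun β h0 h1 => mul_nonneg (hθH β h0 h1) hmα0
    have hθ₂' : 0 ≤ θ₂' := mul_nonneg hθ₂ hmα0
    have hθ'le : θ' ≤ θD * a₁ := mul_le_mul_of_nonneg_left hma₁ hθD
    have hθH'le : ∀ β, 0 ≤ β → β < 1 → θH' β ≤ tH β := fun β h0 h1 => mul_le_mul_of_nonneg_left hma₁ (hθH β h0 h1)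
    have hθ₂'le : θ₂' ≤ θ₂ * a₁ := mul_le_mul_of_nonneg_left hma₁ hθ₂
    -- κθc ≦ ½ on both states, B₂θ₂c² ≦ ½
    have hqS : κS * θ * c ≤ 1 / 2 := by
      have h := small_auxS hκθc hmθ
      calc κS * θ * c = κS * θS * c * ((geo i).M * α₀) := by rw [hθdef]; ring
        _ ≤ 1 / 2 := h
    have hq2 : (𝔖₂ i U).κ * θ * c ≤ 1 / 2 :=
      (mul_le_mul_of_nonneg_right (mul_le_mul_of_nonneg_right hκ2 hθ) hc).trans hqS
    have hq1 : (𝔖₁ i U).κ * θ * c ≤ 1 / 2 :=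
      (mul_le_mul_of_nonneg_right (mul_le_mul_of_nonneg_right hκ1 hθ) hc).trans hqS
    have hq2lt : (𝔖₂ i U).κ * θ * c < 1 := lt_one_of_le_half hq2
    have hq1lt : (𝔖₁ i U).κ * θ * c < 1 := lt_one_of_le_half hq1
    have hinv2 : (1 - (𝔖₂ i U).κ * θ * c)⁻¹ ≤ 2 := inv_one_sub_le_two hq2
    have hinv1 : (1 - (𝔖₁ i U).κ * θ * c)⁻¹ ≤ 2 := inv_one_sub_le_two hq1
    have hinv20 : 0 ≤ (1 - (𝔖₂ i U).κ * θ * c)⁻¹ := inv_nonneg.mpr (sub_nonneg.mpr hq2lt.le)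
    have hinv10 : 0 ≤ (1 - (𝔖₁ i U).κ * θ * c)⁻¹ := inv_nonneg.mpr (sub_nonneg.mpr hq1lt.le)
    have hq₂ : B₂ * θ₂' * c * c ≤ 1 / 2 := by
      have h := small_auxS hB₂c hm₂
      calc B₂ * θ₂' * c * c = B₂ * θ₂ * c * c * ((geo i).M * α₀) := by rw [hθ₂'def]; ring
        _ ≤ 1 / 2 := h
    have hq₂1 : B₂ * θ₂' * c * c < 1 := lt_one_of_le_half hq₂
    -- rates: the two-stage compositions run at ρ₁ = ρ + σ then ρ
    have hρ0 : 0 ≤ ρ := hρ.le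
    have hρ₁0 : 0 ≤ ρ + σ := add_nonneg hρ0 hσ
    have hρ₁S : ρ + σ ≤ δ₀ := by linarith only [hρS, hσ]
    have hρ₁K : ρ + σ + σ ≤ δK := by linarith only [hρδ]
    have hρ₁3 : ρ + σ + σ ≤ δ₃ := by linarith only [hρ₃]
    have hρS' : ρ ≤ δ₀ := by linarith only [hρS, hσ]
    have hρK' : ρ + σ ≤ δK := by linarith only [hρδ, hσ]
    have hρ3' : ρ + σ ≤ δ₃ := by linarith only [hρ₃, hσ]
    have hρKle : ρ ≤ δK := by linarith only [hρδ, hσ]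
    have hαρ : 0 ≤ α * ρ := mul_nonneg hα0 hρ0
    have hρfρ : ρf ≤ ρ := by linarith only [hρf2, hσ, hαρ]
    have hexpf : ∀ y y' : (geo i).Site, Real.exp (-(ρ * (geo i).dist y y')) ≤ Real.exp (-(ρf * (geo i).dist y y')) := fun y y' =>
      Real.exp_le_exp.mpr (neg_le_neg (mul_le_mul_of_nonneg_right hρfρ ((hgeo i).dnn y y')))
    -- the resolvent identities
    have hfix := fix_of_inverses hI.invG0' hI.invG
    have hfix1 := fix_of_inverses hI.invG0' hI.invG1
    have hκ20 : 0 ≤ (𝔖₂ i U).κ := (𝔖₂ i U).κ_nonneg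
    have hκ10 : 0 ≤ (𝔖₁ i U).κ := (𝔖₁ i U).κ_nonneg
    -- RIGHT ENTRIES IN THE STATES (g26 `hasMaj_right_of_stepS`), for a step `hK` at θ and A with A = G₀ + G₀TA
    have rightId : ∀ {A T : Module.End ℝ (X i → ℝ)}, A = (𝔬 i).G0 U + (𝔬 i).G0 U ∘ₗ T ∘ₗ A →
        HasMaj (𝔖₂ i U) (𝔖₂ i U) ((𝔬 i).G0 U ∘ₗ T) (fun a b => θ * Real.exp (-(δK * (geo i).dist a b))) →
        HasMaj (cNorm (R₀ i) (H₀ i) (𝔬 i).blk (hgeo i).lenle 0) (𝔖₂ i U) A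
          (fun a b => 2 * A₀ * Real.exp (-((ρ + σ) * (geo i).dist a b))) := by
      intro A T hfx hK
      obtain ⟨M₀, hM₀, hap⟩ := exists_hasMaj_const_of_dom (hgeo i) (𝔬 i).blk (𝔬 i).blk 0 hΛ₂ hdom2 (A ∘ₗ LinearMap.id)
      have hS : HasMaj (cNorm (R₀ i) (H₀ i) (𝔬 i).blk (hgeo i).lenle 0) (𝔖₂ i U) ((𝔬 i).G0 U ∘ₗ LinearMap.id)
          (fun a b => A₀ * Real.exp (-(δ₀ * (geo i).dist a b))) := by rw [LinearMap.comp_id]; exact hPG0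
      have h := hasMaj_right_of_stepS (hgeo i) hrowi hθ hA₀ hM₀ hρ₁0 hρ₁S hρ₁K hK hS hfx hap hq2lt
      rw [LinearMap.comp_id] at h
      refine h.mono fun a b => mul_le_mul_of_nonneg_right ?_ (Real.exp_nonneg _)
      calc A₀ * (1 - (𝔖₂ i U).κ * θ * c)⁻¹ ≤ A₀ * 2 := mul_le_mul_of_nonneg_left hinv2 hA₀
        _ = 2 * A₀ := by ring
    have rightDs : ∀ {A T : Module.End ℝ (X i → ℝ)}, A = (𝔬 i).G0 U + (𝔬 i).G0 U ∘ₗ T ∘ₗ A →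
        HasMaj (𝔖₁ i U) (𝔖₁ i U) ((𝔬 i).G0 U ∘ₗ T) (fun a b => θ * Real.exp (-(δK * (geo i).dist a b))) →
        HasMaj (cNormR (R₀ i) (H₀ i) (𝔬 i).blkY (hgeo i).lenle 0) (𝔖₁ i U) (A ∘ₗ (𝔬 i).Dstar U)
          (fun a b => 2 * A₀ * Real.exp (-((ρ + σ) * (geo i).dist a b))) := by
      intro A T hfx hK
      obtain ⟨M₀, hM₀, hap⟩ := exists_hasMaj_const_of_dom (hgeo i) (𝔬 i).blkY (𝔬 i).blk 0 hΛ₁ hdom1 (A ∘ₗ (𝔬 i).Dstar U)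
      have hap' : HasMaj (cNormR (R₀ i) (H₀ i) (𝔬 i).blkY (hgeo i).lenle 0) (𝔖₁ i U) (A ∘ₗ (𝔬 i).Dstar U) (fun _ _ => M₀) := by
        have h := hasMaj_toR_src (hgeo i) hap
        rwa [Nat.cast_zero, neg_zero] at h
      have h := hasMaj_right_of_stepS (hgeo i) hrowi hθ hA₀ hM₀ hρ₁0 hρ₁S hρ₁K hK hPDs hfx hap' hq1lt
      refine h.mono fun a b => mul_le_mul_of_nonneg_right ?_ (Real.exp_nonneg _)
      calc A₀ * (1 - (𝔖₁ i U).κ * θ * c)⁻¹ ≤ A₀ * 2 := mul_le_mul_of_nonneg_left hinv1 hA₀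
        _ = 2 * A₀ := by ring
    have rightDds : ∀ {A T : Module.End ℝ (X i → ℝ)}, A = (𝔬 i).G0 U + (𝔬 i).G0 U ∘ₗ T ∘ₗ A →
        HasMaj (𝔖₁ i U) (𝔖₁ i U) ((𝔬 i).G0 U ∘ₗ T) (fun a b => θ * Real.exp (-(δK * (geo i).dist a b))) →
        ∀ (μ : P) (ε : ℝ), 0 < ε →
          HasMaj (bHX i ε) (𝔖₁ i U) (A ∘ₗ Dds i U μ) (fun a b => 2 * AI ε * Real.exp (-((ρ + σ) * (geo i).dist a b))) := by
      intro A T hfx hK μ ε hε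
      obtain ⟨ΛX, hΛX, hsrcX⟩ := hdomX i ε hε
      obtain ⟨M₀, hM₀, hap⟩ := B9StateAprioriL1.exists_hasMaj_const_of_l1_src hΛX hsrcX hΛ₁ hdom1 (A ∘ₗ Dds i U μ)
      have h := hasMaj_right_of_stepS (hgeo i) hrowi hθ (hAI ε hε) hM₀ hρ₁0 hρ₁S hρ₁K hK (hPDds μ ε hε) hfx hap hq1lt
      refine h.mono fun a b => mul_le_mul_of_nonneg_right ?_ (Real.exp_nonneg _)
      calc AI ε * (1 - (𝔖₁ i U).κ * θ * c)⁻¹ ≤ AI ε * 2 := mul_le_mul_of_nonneg_left hinv1 (hAI ε hε)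
        _ = 2 * AI ε := by ring
    have rightH : ∀ {A T : Module.End ℝ (X i → ℝ)} {Cop : Module.End ℝ (Z i → ℝ)}, A = (𝔬 i).G0 U + (𝔬 i).G0 U ∘ₗ T ∘ₗ A →
        HasMaj (𝔖₂ i U) (𝔖₂ i U) ((𝔬 i).G0 U ∘ₗ T) (fun a b => θ * Real.exp (-(δK * (geo i).dist a b))) →
        HasMaj (cNorm (R₀ i) (H₀ i) (𝔬 i).blkZ (hgeo i).lenle 2) (bZ i) Cop (fun a b => B₃ * Real.exp (-(δ₃ * (geo i).dist a b))) →
        HasMaj (cNorm (R₀ i) (H₀ i) (𝔬 i).blkZ (hgeo i).lenle 2) (𝔖₂ i U) (A ∘ₗ ((𝔬 i).Qstar U ∘ₗ Cop))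
          (fun a b => KHu * Real.exp (-((ρ + σ) * (geo i).dist a b))) := by
      intro A T Cop hfx hK hCop
      obtain ⟨M₀, hM₀, hap⟩ := exists_hasMaj_const_of_dom (hgeo i) (𝔬 i).blkZ (𝔬 i).blk 2 hΛ₂ hdom2 (A ∘ₗ ((𝔬 i).Qstar U ∘ₗ Cop))
      have h := H_entry0_of_stateS (hgeo i) hrowi (hκZ i) hc hθ hB₃ hM₀ hσ hρ₁0 hρ₁3 hρ₁K hK hPQs hCop hfx hap hq2lt
      refine h.mono fun a b => mul_le_mul_of_nonneg_right ?_ (Real.exp_nonneg _)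
      calc B₃ * B₃ * c * (1 - (𝔖₂ i U).κ * θ * c)⁻¹ ≤ B₃ * B₃ * c * 2 := mul_le_mul_of_nonneg_left hinv2 hB33
        _ = KHu := by rw [hKHu]; ring
    -- THE MEMBERS AND BLOCKS OF A ∈ {G, G₁} (g27 `B9Thm312WholeMembersRegular`, `…BlocksRegular`, `…LeafBlocksRegular`) with the uniform constants
    have h2A₀ : 0 ≤ 2 * A₀ := by linarith only [hA₀]
    have hL0i : 0 < (geo i).L := lt_of_lt_of_le one_pos (hL1 i)
    have hL4 : (geo i).L ^ (4 : ℝ) ≤ Λu := Real.rpow_le_rpow hL0i.le (hLle i) (by norm_num)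
    have hST : ∀ γ : ℝ, |γ| ≤ 4 → ScaleTransfer (geo i) ρ α ((geo i).L ^ |γ|) (fun y => (geo i).len y ^ γ) ∧
        0 ≤ (geo i).L ^ |γ| ∧ (geo i).L ^ |γ| ≤ Λu := fun γ hγ =>
      ⟨scaleTransfer_rpow_of_260 h260 hsize (hL1 i) (hη i) γ hγ, Real.rpow_nonneg hL0i.le _,
        (B9Ineq347AllEntries.size_condition_compact (geo i).L γ _ (hL1 i) hγ hsize).2.trans hL4⟩
    obtain ⟨hST1, hΛ₁0, hΛ₁le⟩ := hST 1 (by norm_num)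
    obtain ⟨hSTh, hΛh0, hΛhle⟩ := hST (1 / 2) (by rw [abs_of_nonneg (by norm_num : (0 : ℝ) ≤ 1 / 2)]; norm_num)
    obtain ⟨hSTm, hΛm0, hΛmle⟩ := hST (-1) (by norm_num)
    have hST2 : ScaleTransfer (geo i) ρ α (Lc ^ (2 : ℝ)) (fun y => (geo i).len y ^ (2 : ℝ)) := by
      obtain ⟨h2, _, _⟩ := hST 2 (by norm_num)
      have hΛle : (geo i).L ^ |(2 : ℝ)| ≤ Lc ^ (2 : ℝ) := by
        rw [abs_of_pos (by norm_num : (0 : ℝ) < 2)]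
        exact Real.rpow_le_rpow hL0i.le (hLle i) (by norm_num)
      exact fun y y' => (h2 y y').trans (mul_le_mul_of_nonneg_right hΛle (B9Ineq347AllEntries.weight_nonneg (geo i) hL0i (hη i) 2 y))
    have hK₄le : B₂ + B₂ * (θ₂' * (B₂ * (1 - B₂ * θ₂' * c * c)⁻¹) * c) * c ≤ K₄u := by
      have h1 : B₂ * (1 - B₂ * θ₂' * c * c)⁻¹ ≤ 2 * B₂ := const_le_two_mul hB₂ hq₂
      have h0 : 0 ≤ B₂ * (1 - B₂ * θ₂' * c * c)⁻¹ := mul_nonneg hB₂ (inv_nonneg.mpr (by linarith only [hq₂1]))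
      have h2 : θ₂' * (B₂ * (1 - B₂ * θ₂' * c * c)⁻¹) * c ≤ θ₂ * a₁ * (2 * B₂) * c :=
        mul_le_mul_of_nonneg_right (mul_le_mul hθ₂'le h1 h0 (mul_nonneg hθ₂ ha₁.le)) hc
      have h3 : B₂ * (θ₂' * (B₂ * (1 - B₂ * θ₂' * c * c)⁻¹) * c) * c ≤ B₂ * (θ₂ * a₁ * (2 * B₂) * c) * c :=
        mul_le_mul_of_nonneg_right (mul_le_mul_of_nonneg_left h2 hB₂) hc
      rw [hK₄u]; linarith only [h3]
    have hK₄0 : 0 ≤ B₂ + B₂ * (θ₂' * (B₂ * (1 - B₂ * θ₂' * c * c)⁻¹) * c) * c :=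
      add_nonneg hB₂ (mul_nonneg (mul_nonneg hB₂ (mul_nonneg (mul_nonneg hθ₂'
        (mul_nonneg hB₂ (inv_nonneg.mpr (by linarith only [hq₂1])))) hc)) hc)
    have hBΛ : 0 ≤ Bm * Λu := mul_nonneg hBm0 hΛu0
    have hNK : 0 ≤ NP * K₄u := mul_nonneg hNP0 hK₄u0
    have hNKΛ : 0 ≤ NP * K₄u * Λu := mul_nonneg hNK hΛu0
    have hKLa : Bm * (geo i).L ^ |(1 : ℝ)| ≤ KLu := by
      have h := mul_le_mul_of_nonneg_left hΛ₁le hBm0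
      rw [hKLu]; linarith only [h, hBΛ, hNK, hNKΛ]
    have hKLb : Bm * (geo i).L ^ |(1 / 2 : ℝ)| ≤ KLu := by
      have h := mul_le_mul_of_nonneg_left hΛhle hBm0
      rw [hKLu]; linarith only [h, hBΛ, hNK, hNKΛ]
    have hKL3 : NP * (B₂ + B₂ * (θ₂' * (B₂ * (1 - B₂ * θ₂' * c * c)⁻¹) * c) * c) ≤ KLu := by
      have h := mul_le_mul_of_nonneg_left hK₄le hNP0
      rw [hKLu]; linarith only [h, hBΛ, hNK, hNKΛ]
    have hKL3' : NP * (B₂ + B₂ * (θ₂' * (B₂ * (1 - B₂ * θ₂' * c * c)⁻¹) * c) * c) * (geo i).L ^ |(1 : ℝ)| ≤ KLu := by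
      have h := mul_le_mul (mul_le_mul_of_nonneg_left hK₄le hNP0) hΛ₁le hΛ₁0 hNK
      rw [hKLu]; linarith only [h, hBΛ, hNK, hNKΛ]
    have hKL5 : NP * (B₂ + B₂ * (θ₂' * (B₂ * (1 - B₂ * θ₂' * c * c)⁻¹) * c) * c) * (geo i).L ^ |(-1 : ℝ)| ≤ KLu := by
      have h := mul_le_mul (mul_le_mul_of_nonneg_left hK₄le hNP0) hΛmle hΛm0 hNK
      rw [hKLu]; linarith only [h, hBΛ, hNK, hNKΛ]
    have hKL2 : (mN : ℝ) * m * Cev * CL ^ 2 * Real.exp (r * ρf) * KLu ≤ BL2 := le_max_left _ _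
    have hc0le : (𝔖₂ i U).κ * CR * (2 * A₀) * c ≤ Bm := by
      have h1 : (𝔖₂ i U).κ * CR * (2 * A₀) * c ≤ κS * CR * (2 * A₀) * c :=
        mul_le_mul_of_nonneg_right (mul_le_mul_of_nonneg_right (mul_le_mul_of_nonneg_right hκ2 hCR) h2A₀) hc
      rw [hBm]; linarith only [h1, hB₀, hBm2]
    have hc1le : B₀ + (𝔖₂ i U).κ * θ' * (2 * A₀) * c ≤ Bm := by
      have h1 : (𝔖₂ i U).κ * θ' * (2 * A₀) * c ≤ κS * (θD * a₁) * (2 * A₀) * c :=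
        mul_le_mul_of_nonneg_right (mul_le_mul_of_nonneg_right (mul_le_mul hκ2 hθ'le hθ' hκS0) h2A₀) hc
      rw [hBm]; linarith only [h1, hBm1]
    have hc2le : (𝔖₁ i U).κ * CR * (2 * A₀) * c ≤ Bm := by
      have h1 : (𝔖₁ i U).κ * CR * (2 * A₀) * c ≤ κS * CR * (2 * A₀) * c :=
        mul_le_mul_of_nonneg_right (mul_le_mul_of_nonneg_right (mul_le_mul_of_nonneg_right hκ1 hCR) h2A₀) hc
      rw [hBm]; linarith only [h1, hB₀, hBm2]
    have hAI2 : ∀ ε, 0 < ε → 0 ≤ 2 * AI ε := fun ε hε => by have := hAI ε hε; linarith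
    -- the two families: G (T = Δ′_π) and G₁ (T = Δ′_π + Δ⁽²⁾_π), BOTH over the regular state (`…LeafBlocksRegular.blocks_of_state_pairM`)
    have blocksG := blocks_of_state_pairM (hgeo i) (K := GD i) (𝔬 i) (𝔭 i) (Dd i) (Dds i) (bHX i) (Rel i) (ev i) (evY i) hrowi hc hθ' hθH' hθ₂'
      h2A₀ hAI2 hB₀ hB₂ hCR hBm0 hκ2 hκ1 hσ hα0 hρ0 hρS' (le_add_of_nonneg_right hσ) hρK' hρ₁S hq₂1 hρf.le hρf1 hρf2 hBh hBi hBi2 hΛ₁0 hΛm0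
      hST1 hSTh hSTm hfix he1i hH0 hL2s hStLi.t (rightId hfix hS2.step) (rightDs hfix hS1.step) (rightDds hfix hS1.step) hRd2 hRd1 hSD.1
      (fun β h0 h1 => (hPY β h0 h1).1) (fun ν => (hSDd ν).1) (fun β h0 h1 => (hPX β h0 h1).1) (fun ν β h0 h1 => (hPXd ν β h0 h1).1)
      hc0le hc1le hc2le hKLu0 hKLa hKLb hKL3 hKL3' hKL5 hsymG htrG hRd₂ (hmult i) (hnbr i) hCL1 (hCL i) hCev hlD0 hlD1 hlD2 hlD3 hlD4 hlD5 hH1D hIRD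
    have blocksG1 := blocks_of_state_pairM (hgeo i) (K := G₁ i) (𝔬 i) (𝔭 i) (Dd i) (Dds i) (bHX i) (Rel i) (ev i) (evY i) hrowi hc hθ' hθH' hθ₂'
      h2A₀ hAI2 hB₀ hB₂ hCR hBm0 hκ2 hκ1 hσ hα0 hρ0 hρS' (le_add_of_nonneg_right hσ) hρK' hρ₁S hq₂1 hρf.le hρf1 hρf2 hBh hBi hBi2 hΛ₁0 hΛm0
      hST1 hSTh hSTm hfix1 he1i hH0 hL2s hStLi.t1 (rightId hfix1 hS2.step1) (rightDs hfix1 hS1.step1) (rightDds hfix1 hS1.step1) hRd2 hRd1 hSD.2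
      (fun β h0 h1 => (hPY β h0 h1).2) (fun ν => (hSDd ν).2) (fun β h0 h1 => (hPX β h0 h1).2) (fun ν β h0 h1 => (hPXd ν β h0 h1).2)
      hc0le hc1le hc2le hKLu0 hKLa hKLb hKL3 hKL3' hKL5 hsymG1 htrG1 hRd₂ (hmult i) (hnbr i) hCL1 (hCL i) hCev hl10 hl11 hl12 hl13 hl14 hl15 hH11 hIR1
    -- the residual at the uniform families
    have hmCE : 0 ≤ (m : ℝ) * CL * Real.exp (r * ρf) := mul_nonneg (mul_nonneg hm00 (zero_le_one.trans hCL1)) (Real.exp_nonneg _)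
    have weak : ∀ {K : B9.KernelFamily (geo i) (bg i)},
        L2Block K ((mN : ℝ) * m * Cev * CL ^ 2 * Real.exp (r * ρf) * KLu) ρf U →
        B9.Ineq343_345 K (fun β => m * CL * Real.exp (r * ρf) * (Bh β + κS * θH' β * (2 * A₀) * c))
          (fun ε => Real.exp (r * ρf) * (Bi ε + κS * θ' * (2 * AI ε) * c))
          (fun ε β => CL * Real.exp (r * ρf) * (Bi2 ε β + κS * θH' β * (2 * AI (β + ε)) * c)) ρf U →
        L2Block K BL2 ρf U ∧ B9.Ineq343_345 K Bβo Bεo Bεβo ρf U := by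
      intro K hl2 hho
      refine ⟨l2Block_mono (S i) hl2 hKL2 hBL20 le_rfl, ineq343_345_mono_on (S i) hho (hgeo i).lenpos ?_ ?_ ?_ le_rfl⟩
      · intro β h0 h1
        refine ⟨le_trans ?_ ((le_max_left _ _).trans (le_max_left _ _)), hBβo0 β⟩
        refine mul_le_mul_of_nonneg_left ?_ hmCE
        have h2 : κS * θH' β * (2 * A₀) * c ≤ κS * tH β * (2 * A₀) * c :=
          mul_le_mul_of_nonneg_right (mul_le_mul_of_nonneg_right (mul_le_mul_of_nonneg_left (hθH'le β h0 h1) hκS0) h2A₀) hc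
        simp only [hBhu]; linarith only [h2]
      · intro ε hε hε1
        refine ⟨le_trans ?_ (le_max_left _ _), hBεo0 ε⟩
        refine mul_le_mul_of_nonneg_left ?_ (Real.exp_nonneg _)
        have h2 : κS * θ' * (2 * AI ε) * c ≤ κS * (θD * a₁) * (2 * AI ε) * c :=
          mul_le_mul_of_nonneg_right (mul_le_mul_of_nonneg_right (mul_le_mul_of_nonneg_left hθ'le hκS0) (hAI2 ε hε)) hc
        linarith only [h2]
      · intro ε β hε hε1 h0 h1
        refine ⟨le_trans ?_ (le_max_left _ _), hBεβo0 ε β⟩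
        refine mul_le_mul_of_nonneg_left ?_ (mul_nonneg (zero_le_one.trans hCL1) (Real.exp_nonneg _))
        have h2 : κS * θH' β * (2 * AI (β + ε)) * c ≤ κS * tH β * (2 * AI (β + ε)) * c :=
          mul_le_mul_of_nonneg_right (mul_le_mul_of_nonneg_right (mul_le_mul_of_nonneg_left (hθH'le β h0 h1) hκS0) (hAI2 (β + ε) (by linarith only [h0, hε]))) hc
        linarith only [h2]
    have resG : _ ∧ (L2Block (GD i) BL2 ρf U ∧ B9.Ineq343_345 (GD i) Bβo Bεo Bεβo ρf U) := ⟨blocksG.1, weak blocksG.2.1 blocksG.2.2⟩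
    have resG1 : _ ∧ (L2Block (G₁ i) BL2 ρf U ∧ B9.Ineq343_345 (G₁ i) Bβo Bεo Bεβo ρf U) := ⟨blocksG1.1, weak blocksG1.2.1 blocksG1.2.2⟩
    -- THE H-WORDS THROUGH THE STATE (`…LeafBlocksRegular.hwords_uniform_of_state`): H = A∘(Q*C) INTO 𝔖₂ (`rightH`), read back, ∇_UH, (3.133)
    have hBH0le : (𝔖₂ i U).κ * CR * KHu * c ≤ BHm := by
      have h1 : (𝔖₂ i U).κ * CR * KHu * c ≤ κS * CR * KHu * c :=
        mul_le_mul_of_nonneg_right (mul_le_mul_of_nonneg_right (mul_le_mul_of_nonneg_right hκ2 hCR) hKHu0) hc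
      rw [hBHm]; linarith only [h1, hB33, hBHm2]
    have hBH1le : B₃ * B₃ * c + (𝔖₂ i U).κ * θ' * KHu * c ≤ BHm := by
      have h1 : (𝔖₂ i U).κ * θ' * KHu * c ≤ κS * (θD * a₁) * KHu * c :=
        mul_le_mul_of_nonneg_right (mul_le_mul_of_nonneg_right (mul_le_mul hκ2 hθ'le hθ' hκS0) hKHu0) hc
      rw [hBHm]; linarith only [h1, hBHm1]
    have hCβle : ∀ β, 0 ≤ β → β < 1 →
        CL ^ 2 * Real.exp (r * ((1 - α) * ρ)) * ((Bq β * B₃ * c + (𝔖₂ i U).κ * θH' β * KHu * c) * Lc ^ (2 : ℝ)) ≤ Bβo β := by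
      intro β h0 h1
      have h2 : (𝔖₂ i U).κ * θH' β * KHu * c ≤ κS * tH β * KHu * c :=
        mul_le_mul_of_nonneg_right (mul_le_mul_of_nonneg_right (mul_le_mul hκ2 (hθH'le β h0 h1) (hθH' β h0 h1) hκS0) hKHu0) hc
      have h3 : (Bq β * B₃ * c + (𝔖₂ i U).κ * θH' β * KHu * c) * Lc ^ (2 : ℝ) ≤ (Bq β * B₃ * c + κS * tH β * KHu * c) * Lc ^ (2 : ℝ) :=
        mul_le_mul_of_nonneg_right (by linarith only [h2]) hLc2
      exact ((mul_le_mul_of_nonneg_left h3 hCH30).trans (le_max_right _ _)).trans (le_max_left _ _)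
    have hδhalf : ρf / 2 ≤ (1 - α) * ρ := by linarith only [hρf1, hσ, hρf.le]
    have resH := hwords_uniform_of_state (hgeo i) (S i) (𝔬 i) (𝔭 i) hrowi (hκZ i) hc hθ' hθH' hKHu0 hCR hB₃ hBq hLc2 hσ hρ0
      (le_add_of_nonneg_right hσ) hρ₁S hρ₁3 hρK' (by linarith only [hα]) hδhalf hBH0le hBH1le hCβle hBβo0 hI.eq126 hfix (by rw [hI.eq126]; exact rightH hfix hS2.step hLH.c2) hRd2 hSD.1
      (fun β h0 h1 => (hPY β h0 h1).1) hLH.dgQs hLH.c2 hHH.pQ hHC0 hCL1 (hCL i) hST2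
    have resH1 := hwords_uniform_of_state (hgeo i) (S i) (𝔬 i) (𝔭 i) hrowi (hκZ i) hc hθ' hθH' hKHu0 hCR hB₃ hBq hLc2 hσ hρ0
      (le_add_of_nonneg_right hσ) hρ₁S hρ₁3 hρK' (by linarith only [hα]) hδhalf hBH0le hBH1le hCβle hBβo0 hI.eq129 hfix1 (by rw [hI.eq129]; exact rightH hfix1 hS2.step1 hLH.c12) hRd2 hSD.2
      (fun β h0 h1 => (hPY β h0 h1).2) hLH.dgQs hLH.c12 hHH.pQ hHC1 hCL1 (hCL i) hST2
    -- THE PINS: the series over the regular state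
    obtain ⟨MG, hMG, hapG⟩ := exists_hasMaj_const_of_dom (hgeo i) (𝔬 i).blk (𝔬 i).blk 0 hΛ₂ hdom2 ((𝔬 i).G U)
    obtain ⟨MG1, hMG1, hapG1⟩ := exists_hasMaj_const_of_dom (hgeo i) (𝔬 i).blk (𝔬 i).blk 0 hΛ₂ hdom2 ((𝔬 i).G1 U)
    have hσK : σ ≤ δK := by linarith only [hρδ, hρ0, hσ]
    have hσ0 : σ ≤ δ₀ := by linarith only [hρS, hρ0, hσ]
    have hRW := hasRWExp_of_stepS (hgeo i) hrowi hθ hσK hσ0 hMG hMG1 hCR hq2lt hS2 hI hapG hapG1 hRd2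
    have hRWH := hasRWExpH_of_stepS (hgeo i) hrowi hθ hσK hσ0 hMG hMG1 hCR hq2lt hS2 hI hapG hapG1 hRd2
    -- assembling the per-member statement
    refine ⟨fun A hA => ?_, fun Hop hHop => ?_, ⟨hRW, hRWH⟩, fun K hK => ?_, fun Hk' hK' => ?_⟩
    · have hA2 : A = (𝔬 i).G U ∨ A = (𝔬 i).G1 U := by simpa using hA
      rcases hA2 with rfl | rfl
      · exact resG.1
      · exact resG1.1
    · have hH2 : Hop = (𝔬 i).Hm U ∨ Hop = (𝔬 i).H1m U := by simpa using hHop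
      rcases hH2 with rfl | rfl
      · exact resH.1
      · exact resH1.1
    · have hK2 : K = GD i ∨ K = G₁ i := by simpa using hK
      rcases hK2 with rfl | rfl
      · exact resG.2
      · exact resG1.2
    · have hK2 : Hk' = Hk i ∨ Hk' = H₁k i := by simpa using hK'
      rcases hK2 with rfl | rfl
      · exact resH.2
      · exact resH1.2
  exact thm312Printed_of_membersRelHZ 𝔬 R₀ H₀ GD G₁ Hk H₁k ev evY Rel m r₁ ρ a₁' M₁' BL2 ρf Bm BHm α Lc Bβo Bεo Bεβo
    hr₁ hρ ha₁'pos hM₁'pos hρf hBm0 hBHm0 hα hBβo0 hBεo0 hBεβo0 hgeo S hL1 hLle hη hL21 hsat hmult hRdist hRlen hcoR hco1R hcoHR hcoG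
    (fun i hM α₀ hα₀ hMa U hU hU' => hmodel i (hle₁ hM) α₀ hα₀ (hMa.trans ha₁'le) U hU hU')
    (fun i hM α₀ hα₀ hMa U hU hU' => (key i hM α₀ hα₀ hMa U hU hU').1)
    (fun i hM α₀ hα₀ hMa U hU hU' => (key i hM α₀ hα₀ hMa U hU hU').2.1)
    (fun i hM α₀ hα₀ hMa U hU hU' => (key i hM α₀ hα₀ hMa U hU hU').2.2.1)
    (fun i hM α₀ hα₀ hMa U hU hU' => (key i hM α₀ hα₀ hMa U hU hU').2.2.2)

end Family

end

end Literature.MathematicalPhysics.QuantumFieldTheory.Balaban1983to89.B9Thm312WholeLeafCompletePairMBZSL
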